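import Summits.ValiantsHypothesis.ValiantsHypothesis.Theorems.BarrierLeverPriorityPeelingMoves
import Literature.Analysis.TotalPositivity.MultiplyPositiveProofs

/-!
# Route BarrierLever — the HUB LEMMA for layout determinants (TT, item 19152 / residual 19761)

Library file (`--supports stmt-ValiantsHypothesis-19152`; cell valiant-natproofs, rung V4, 𝒟-side of door (c);
prover gen 8, memo `HOME/prover/gen8/HUB-MEMO-g8.md` §1). It does NOT import the route file.

**Setting.** For an `n × n` matrix `G` and families of index maps `S T : Fin r → Fin h → Fin n` the LAYOUT
MATRIX is `(det G[S i, T j])_{ij}`; the pair `(S,T)` is ALIVE if this matrix is nonsingular for some `G`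
(equivalently for generic `G`). Item 19152 (TT) says that every pair of transversal families is alive.

**The hub lemma (`alive_trans_of_hub`).** Let `H : Fin r → Fin h → Fin n` be a family with strictly
increasing rows, injective as a family, which is the UNIQUE such family — up to a permutation of `Fin r` —
with its `ψ`-weight `Σ_j Σ_a ψ (H j a)` for some weight `ψ : Fin n → ℕ` (e.g. a threshold family: the `r`
heaviest `h`-subsets; with `ψ x = B^x`, `B > r`, this is «unique family with its literal-degree vector»).
If `(S, H)` and `(T, H)` are alive then `(S, T)` is alive.

**Proof.** Take numeric `P`, `Q` witnessing the two hypotheses and put `g(t) := P · diag(t^{ψ x}) · Qᵀ`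
over `ℂ[t]`. By the Cauchy–Binet formula (tree: `Literature.Analysis.TotalPositivity.det_mul_eq_sum_strictMono`)
`det g(t)[S i, T j] = Σ_a det P[S i, a] · t^{ψ(a)} · det Q[T j, a]` over increasing `a : Fin h → Fin n`, i.e. the
layout matrix factors as `Xᵀ · diag(t^{ψ(a)}) · Y` through the index type of all `a` (a linear order via
`Lex`); Cauchy–Binet again gives `det = Σ_𝒶 det X[𝒶, ·] · t^{ψ(𝒶)} · det Y[𝒶, ·]` over increasing
`𝒶 : Fin r → (Fin h → Fin n)`. The coefficient of `t^{ψ(H)}` collects exactly the `𝒶` enumerating a family of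
weight `ψ(H)` with increasing rows, which by uniqueness is the sorted enumeration of `H` alone; its term is
`det[det P[S i, H j]] · det[det Q[T i, H j]] ≠ 0` (the two permutation signs cancel). So the layout
determinant of `g(t)` is a nonzero polynomial in `t`; evaluate at a non-root.

WHAT THIS IS NOT: a transitivity device («alive through a hub»); by itself it proves no layout alive and
says nothing on the existence of hubs/certificates (memo §3–§6), on TT / TNS / item 19717 in general, on crux
stmt-ValiantsHypothesis-14610, or on `VP` versus `VNP`.
-/

-- layout Summits/ValiantsHypothesis/ValiantsHypothesis forces the duplicated namespace component
set_option linter.dupNamespace false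

namespace Summit.ValiantsHypothesis.ValiantsHypothesis.Theorems.BarrierLever.Hub

open Finset Matrix Polynomial

open scoped Classical

variable {n h r : ℕ}

/-- Submatrix of `diagonal d * Q` with rows selected by `a`: a diagonal row scaling of `Q[a, c]`. -/
theorem submatrix_diagonal_mul {R : Type*} [CommRing R] {ι κ : Type*} [Fintype ι] [DecidableEq ι]
    [Fintype κ] [DecidableEq κ] {m : Type*}
    (d : ι → R) (Q : Matrix ι m R) (a : κ → ι) (c : κ → m) :
    (Matrix.diagonal d * Q).submatrix a c = Matrix.diagonal (d ∘ a) * Q.submatrix a c := by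
  ext k l
  simp only [Matrix.submatrix_apply, Matrix.diagonal_mul, Function.comp]

/-- Determinant of a row-scaled submatrix. -/
theorem det_submatrix_diagonal_mul {R : Type*} [CommRing R] {ι : Type*} [Fintype ι] [DecidableEq ι]
    {k : ℕ} (d : ι → R) (Q : Matrix ι (Fin k) R) (a : Fin k → ι) :
    ((Matrix.diagonal d * Q).submatrix a id).det = (∏ i, d (a i)) * (Q.submatrix a id).det := by
  rw [submatrix_diagonal_mul, Matrix.det_mul, Matrix.det_diagonal]
  rfl

/-- **The hub lemma.** See the module docstring. -/
theorem alive_trans_of_hub (S T H : Fin r → Fin h → Fin n) (ψ : Fin n → ℕ)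
    (hHm : ∀ j, StrictMono (H j)) (hHi : Function.Injective H)
    (hH : ∀ H' : Fin r → Fin h → Fin n, (∀ j, StrictMono (H' j)) → Function.Injective H' →
      (∑ j, ∑ a, ψ (H' j a)) = (∑ j, ∑ a, ψ (H j a)) → ∃ σ : Equiv.Perm (Fin r), ∀ j, H' j = H (σ j))
    (hS : ∃ G : Matrix (Fin n) (Fin n) ℂ,
      (Matrix.of fun i j : Fin r => (G.submatrix (S i) (H j)).det).det ≠ 0)
    (hT : ∃ G : Matrix (Fin n) (Fin n) ℂ,
      (Matrix.of fun i j : Fin r => (G.submatrix (T i) (H j)).det).det ≠ 0) :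
    ∃ G : Matrix (Fin n) (Fin n) ℂ,
      (Matrix.of fun i j : Fin r => (G.submatrix (S i) (T j)).det).det ≠ 0 := by
  obtain ⟨P, hP⟩ := hS
  obtain ⟨Q, hQ⟩ := hT
  -- the index type of all candidate rows-of-the-middle, linearly ordered
  let ι := Lex (Fin h → Fin n)
  -- ψ-weight of a middle index and of a family of them
  let wt : (Fin h → Fin n) → ℕ := fun a => ∑ c, ψ (a c)
  -- the one-parameter matrix g(t) = P · diag(t^ψ) · Qᵀ over ℂ[X]
  set D : Matrix (Fin n) (Fin n) ℂ[X] := Matrix.diagonal fun x => (X : ℂ[X]) ^ (ψ x) with hD_def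
  set Pc : Matrix (Fin n) (Fin n) ℂ[X] := P.map Polynomial.C with hPc_def
  set Qc : Matrix (Fin n) (Fin n) ℂ[X] := Q.map Polynomial.C with hQc_def
  set g : Matrix (Fin n) (Fin n) ℂ[X] := Pc * (D * Qcᵀ) with hg_def
  set M : Matrix (Fin r) (Fin r) ℂ[X] := Matrix.of fun i j => (g.submatrix (S i) (T j)).det with hM_def
  -- the two factor matrices through ι
  set Xm : Matrix ι (Fin r) ℂ[X] := Matrix.of fun a i =>
    if StrictMono (ofLex a) then Polynomial.C ((P.submatrix (S i) (ofLex a)).det) else 0 with hXm_def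
  set Ym : Matrix ι (Fin r) ℂ[X] := Matrix.of fun a j =>
    Polynomial.C ((Q.submatrix (T j) (ofLex a)).det) with hYm_def
  set Wd : Matrix ι ι ℂ[X] := Matrix.diagonal fun a => (X : ℂ[X]) ^ (wt (ofLex a)) with hWd_def
  -- (1) inner Cauchy–Binet: M = Xmᵀ * (Wd * Ym)
  have hinner : ∀ i j, M i j = ∑ a : ι, Xm a i * ((X : ℂ[X]) ^ (wt (ofLex a)) * Ym a j) := by
    intro i j
    rw [hM_def, Matrix.of_apply, hg_def,
      Matrix.submatrix_mul _ _ (S i) id (T j) Function.bijective_id,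
      Literature.Analysis.TotalPositivity.det_mul_eq_sum_strictMono, Finset.sum_filter]
    refine Fintype.sum_equiv (toLex) _ _ (fun a => ?_)
    rw [hXm_def, hYm_def, Matrix.of_apply, Matrix.of_apply, ofLex_toLex]
    split_ifs with ha
    · -- det (Pc.submatrix (S i) a) = C (det ...); det ((D * Qcᵀ).submatrix a (T j)) = X^wt * C(det ...)
      have h1 : (Pc.submatrix (S i) id).submatrix id a = (P.submatrix (S i) a).map Polynomial.C := by
        ext k l; simp [hPc_def]
      have h2 : ((D * Qcᵀ).submatrix id (T j)).submatrix a id =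
          Matrix.diagonal (fun k => (X : ℂ[X]) ^ ψ (a k)) * (Q.submatrix (T j) a)ᵀ.map Polynomial.C := by
        ext k l
        simp [hD_def, hQc_def, Matrix.diagonal_mul, Matrix.submatrix_apply, Matrix.transpose_apply]
      have hdet1 : ((P.submatrix (S i) a).map Polynomial.C).det = Polynomial.C (P.submatrix (S i) a).det :=
        (RingHom.map_det (Polynomial.C : ℂ →+* ℂ[X]) _).symm
      have hdet2 : ((Q.submatrix (T j) a)ᵀ.map Polynomial.C).det = Polynomial.C (Q.submatrix (T j) a).det := by
        have e := (RingHom.map_det (Polynomial.C : ℂ →+* ℂ[X]) ((Q.submatrix (T j) a)ᵀ)).symm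
        rw [Matrix.det_transpose] at e
        exact e
      have hprod : (∏ k, (X : ℂ[X]) ^ ψ (a k)) = X ^ (wt a) := Finset.prod_pow_eq_pow_sum _ _ _
      rw [h1, h2, Matrix.det_mul, Matrix.det_diagonal, hdet1, hdet2, hprod]
    · simp
  have hMfac : M = Xmᵀ * (Wd * Ym) := by
    refine Matrix.ext fun i j => ?_
    rw [hinner i j, Matrix.mul_apply]
    refine Finset.sum_congr rfl fun a _ => ?_
    rw [Matrix.transpose_apply, hWd_def, Matrix.diagonal_mul]
  -- (2) constant versions of the factor matrices
  set XmR : Matrix ι (Fin r) ℂ := Matrix.of fun a i =>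
    if StrictMono (ofLex a) then (P.submatrix (S i) (ofLex a)).det else 0 with hXmR_def
  set YmR : Matrix ι (Fin r) ℂ := Matrix.of fun a j => (Q.submatrix (T j) (ofLex a)).det with hYmR_def
  have hXmC : Xm = XmR.map Polynomial.C := by
    refine Matrix.ext fun a i => ?_
    rw [hXm_def, hXmR_def, Matrix.map_apply, Matrix.of_apply, Matrix.of_apply]
    split_ifs <;> simp
  have hYmC : Ym = YmR.map Polynomial.C := by
    refine Matrix.ext fun a i => ?_
    rw [hYm_def, hYmR_def, Matrix.map_apply, Matrix.of_apply, Matrix.of_apply]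
  -- weight of an r-tuple of middle indices
  let Wt : (Fin r → ι) → ℕ := fun 𝒶 => ∑ k, wt (ofLex (𝒶 k))
  let cc : (Fin r → ι) → ℂ := fun 𝒶 => (XmR.submatrix 𝒶 id).det * (YmR.submatrix 𝒶 id).det
  -- (3) outer Cauchy–Binet: det M = Σ_𝒶 C(cc 𝒶) * X^(Wt 𝒶)
  have hdetM : M.det = ∑ 𝒶 ∈ (univ : Finset (Fin r → ι)).filter (fun t => StrictMono t),
      Polynomial.C (cc 𝒶) * (X : ℂ[X]) ^ (Wt 𝒶) := by
    rw [hMfac, Literature.Analysis.TotalPositivity.det_mul_eq_sum_strictMono]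
    refine Finset.sum_congr rfl fun 𝒶 _ => ?_
    have e1 : (Xmᵀ.submatrix id 𝒶).det = Polynomial.C ((XmR.submatrix 𝒶 id).det) := by
      rw [← Matrix.transpose_submatrix, Matrix.det_transpose, hXmC]
      exact (RingHom.map_det (Polynomial.C : ℂ →+* ℂ[X]) (XmR.submatrix 𝒶 id)).symm
    have e2 : ((Wd * Ym).submatrix 𝒶 id).det =
        (X : ℂ[X]) ^ (Wt 𝒶) * Polynomial.C ((YmR.submatrix 𝒶 id).det) := by
      rw [hWd_def, det_submatrix_diagonal_mul, Finset.prod_pow_eq_pow_sum, hYmC]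
      congr 1
      exact (RingHom.map_det (Polynomial.C : ℂ →+* ℂ[X]) (YmR.submatrix 𝒶 id)).symm
    rw [e1, e2, map_mul]
    ring
  -- (4) the hub tuple 𝒶₀ : sorted enumeration of the members of H
  set s : Finset ι := univ.image (fun j => toLex (H j)) with hs_def
  have hinjH : Function.Injective (fun j => toLex (H j)) := fun a b hab => hHi (toLex.injective hab)
  have hs_card : s.card = r := by
    rw [hs_def, Finset.card_image_of_injective _ hinjH, Finset.card_univ, Fintype.card_fin]
  set 𝒶₀ : Fin r → ι := ⇑(s.orderEmbOfFin hs_card) with h𝒶₀_def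
  have h𝒶₀_mono : StrictMono 𝒶₀ := (s.orderEmbOfFin hs_card).strictMono
  have h𝒶₀_mem : ∀ k, 𝒶₀ k ∈ s := fun k => by
    rw [h𝒶₀_def]; exact Finset.orderEmbOfFin_mem s hs_card k
  -- a permutation σ₀ with 𝒶₀ k = toLex (H (σ₀ k))
  have hex : ∀ k, ∃ j, 𝒶₀ k = toLex (H j) := by
    intro k
    have hk := h𝒶₀_mem k
    rw [hs_def, Finset.mem_image] at hk
    obtain ⟨j, _, hj⟩ := hk
    exact ⟨j, hj.symm⟩
  choose σf hσf using hex
  have hσf_inj : Function.Injective σf := by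
    intro k k' hkk'
    apply h𝒶₀_mono.injective
    rw [hσf k, hσf k', hkk']
  have hσf_bij : Function.Bijective σf := by
    rw [Fintype.bijective_iff_injective_and_card]
    exact ⟨hσf_inj, rfl⟩
  set σ₀ : Equiv.Perm (Fin r) := Equiv.ofBijective σf hσf_bij with hσ₀_def
  have hσ₀ : ∀ k, 𝒶₀ k = toLex (H (σ₀ k)) := fun k => hσf k
  -- its weight is N := Σ_j wt (H j)
  have hWt₀ : Wt 𝒶₀ = ∑ j, wt (H j) := by
    show (∑ k, wt (ofLex (𝒶₀ k))) = ∑ j, wt (H j)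
    have : (fun k => wt (ofLex (𝒶₀ k))) = fun k => wt (H (σ₀ k)) := by
      funext k; rw [hσ₀ k, ofLex_toLex]
    rw [this]
    exact Equiv.sum_comp σ₀ (fun j => wt (H j))
  -- its coefficient is det N_P * det N_Q (signs cancel)
  have hcc₀ : cc 𝒶₀ = (Matrix.of fun i j : Fin r => (P.submatrix (S i) (H j)).det).det *
      (Matrix.of fun i j : Fin r => (Q.submatrix (T i) (H j)).det).det := by
    have eX : XmR.submatrix 𝒶₀ id =
        ((Matrix.of fun i j : Fin r => (P.submatrix (S i) (H j)).det).submatrix id σ₀)ᵀ := by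
      refine Matrix.ext fun k i => ?_
      rw [Matrix.submatrix_apply, hXmR_def, Matrix.of_apply, hσ₀ k, ofLex_toLex, if_pos (hHm _)]
      rfl
    have eY : YmR.submatrix 𝒶₀ id =
        ((Matrix.of fun i j : Fin r => (Q.submatrix (T i) (H j)).det).submatrix id σ₀)ᵀ := by
      refine Matrix.ext fun k i => ?_
      rw [Matrix.submatrix_apply, hYmR_def, Matrix.of_apply, hσ₀ k, ofLex_toLex]
      rfl
    show (XmR.submatrix 𝒶₀ id).det * (YmR.submatrix 𝒶₀ id).det = _
    rw [eX, eY, Matrix.det_transpose, Matrix.det_transpose, Matrix.det_permute', Matrix.det_permute']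
    have hsq : ((Equiv.Perm.sign σ₀ : ℤˣ) : ℤ) * ((Equiv.Perm.sign σ₀ : ℤˣ) : ℤ) = 1 := by
      rw [← Units.val_mul, Int.units_mul_self, Units.val_one]
    have hsqC : (((Equiv.Perm.sign σ₀ : ℤˣ) : ℤ) : ℂ) * (((Equiv.Perm.sign σ₀ : ℤˣ) : ℤ) : ℂ) = 1 := by
      rw [← Int.cast_mul, hsq, Int.cast_one]
    linear_combination ((Matrix.of fun i j : Fin r => (P.submatrix (S i) (H j)).det).det *
      (Matrix.of fun i j : Fin r => (Q.submatrix (T i) (H j)).det).det) * hsqC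
  -- (5) uniqueness: any strictly increasing 𝒶 of weight N with cc 𝒶 ≠ 0 is 𝒶₀
  have huniq : ∀ 𝒶 : Fin r → ι, StrictMono 𝒶 → Wt 𝒶 = ∑ j, wt (H j) → cc 𝒶 ≠ 0 → 𝒶 = 𝒶₀ := by
    intro 𝒶 h𝒶 hW hc
    -- all rows of 𝒶 are strictly increasing (else a zero row of XmR kills cc)
    have hrows : ∀ k, StrictMono (ofLex (𝒶 k)) := by
      intro k
      by_contra hk
      apply hc
      have hz : (XmR.submatrix 𝒶 id).det = 0 := by
        refine Matrix.det_eq_zero_of_row_eq_zero k (fun i => ?_)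
        rw [Matrix.submatrix_apply, hXmR_def, Matrix.of_apply, if_neg hk]
      show (XmR.submatrix 𝒶 id).det * (YmR.submatrix 𝒶 id).det = 0
      rw [hz, zero_mul]
    have hinj : Function.Injective (fun k => ofLex (𝒶 k)) :=
      fun k k' hkk' => h𝒶.injective (ofLex.injective hkk')
    obtain ⟨σ, hσ⟩ := hH (fun k => ofLex (𝒶 k)) hrows hinj hW
    have hmem : ∀ k, 𝒶 k ∈ s := by
      intro k
      rw [hs_def, Finset.mem_image]
      refine ⟨σ k, Finset.mem_univ _, ?_⟩
      have hk : ofLex (𝒶 k) = H (σ k) := hσ k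
      rw [← hk, toLex_ofLex]
    rw [h𝒶₀_def]
    exact Finset.orderEmbOfFin_unique hs_card hmem h𝒶
  -- (6) the coefficient of X^N in det M is cc 𝒶₀ ≠ 0
  have hcoeff : M.det.coeff (∑ j, wt (H j)) = cc 𝒶₀ := by
    rw [hdetM, Polynomial.finsetSum_coeff]
    rw [Finset.sum_eq_single_of_mem 𝒶₀ (Finset.mem_filter.mpr ⟨Finset.mem_univ _, h𝒶₀_mono⟩)]
    · rw [Polynomial.coeff_C_mul_X_pow, if_pos hWt₀.symm]
    · intro 𝒶 h𝒶 hne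
      rw [Finset.mem_filter] at h𝒶
      rw [Polynomial.coeff_C_mul_X_pow]
      split_ifs with hW
      · by_contra hc
        exact hne (huniq 𝒶 h𝒶.2 hW.symm hc)
      · rfl
  have hdet_ne : M.det ≠ 0 := by
    intro h0
    have := hcoeff
    rw [h0, Polynomial.coeff_zero, hcc₀] at this
    exact mul_ne_zero hP hQ this.symm
  -- (7) evaluate at a non-root
  obtain ⟨t₀, ht₀⟩ := PriorityPeeling.exists_eval_ne_zero_of_ne_zero _ hdet_ne
  refine ⟨g.map (Polynomial.eval t₀), ?_⟩
  have := PriorityPeeling.map_layoutDet (Polynomial.evalRingHom t₀) S T g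
  rw [Polynomial.coe_evalRingHom] at this
  rw [← this, ← hM_def]
  exact ht₀

end Summit.ValiantsHypothesis.ValiantsHypothesis.Theorems.BarrierLever.Hub
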